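import Summits.NavierStokesRegularity.NavierStokesRegularity.Theorems.PeepholeVorticityDoorCoreDefs

/-!
# PeepholeVorticityDoorChebyshev — door S29 «PeepholeVorticityDoor», FILE 2: Stub B4 `ChebyshevPullbackS29` (Chebyshev in `s ∈ [t₀,2t₀]` + pull-back to the door's window)

Plate of record: nsreg-p1 g23 `r27/ChebyshevB4.lean` sha16 36d56b598dd0b2a4 (farm rc 0 · 0 sorry; refuter1 g9 K-65 PASS: statement IDENTICAL to
`r27/Skeleton29.lean` a83afe48495060f1), re-based by ns-s29-p2 g2 on `PeepholeVorticityDoorCoreDefs` (the §1 quantities and the stub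
text `ChebyshevPullbackS29` are imported from there, local copies dropped; proof bodies untouched; DIRECTOR-NS #135 (b)).

Chebyshev / first mean value in `s ∈ [t₀, 2t₀]` for the CONTINUOUS slice function `s ↦ ∫_{B(0,3Rℓ)} |w(s,x)|² dx`
(`exists_le_setAverage`), then pull back to the door's conclusion at `t' = t̄ − s` (`B(0, 2R√(−t')) ⊆ B(0, 3Rℓ)`,
Bochner → `lintegral`, `4√(−t') ≤ 5ℓ`).  The work is done for a generic `w : ℝ → ℝ³ → ℝ³` (`w s = curl (u (t̄ − s))` for the door).

Closes `theorem chebyshevPullbackS29_holds : ChebyshevPullbackS29` — one of the six hypotheses of `peepholeToCore_of_stubs`.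
WHAT THIS IS NOT: not NS regularity; not `NoTypeII` (stmt-0056 OPEN); analytic bookkeeping for a HYPOTHETICAL-blow-up door.
-/

noncomputable section

set_option linter.dupNamespace false

namespace Summit.NavierStokesRegularity.NavierStokesRegularity.Theorems.PeepholeVorticityDoor

open MeasureTheory Set Function Filter Topology TopologicalSpace Metric
open scoped RealInnerProductSpace NNReal ENNReal Topology
open Literature.Analysis Literature.Analysis.FluidPDE

/-! ## helpers (generic `w`) -/

/-- continuity of `s ↦ ∫_{B(0,ρ)} |w(s,x)|² dx` on `[a, b]` from joint continuity on `[a,b] × B̄(0,ρ')`, `ρ ≤ ρ'`. -/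
theorem continuousOn_sqNormIntegral {w : ℝ → EuclideanSpace ℝ (Fin 3) → EuclideanSpace ℝ (Fin 3)} {a b ρ ρ' : ℝ}
    (hρ : ρ ≤ ρ')
    (hw : ContinuousOn (uncurry w) (Icc a b ×ˢ closedBall (0 : EuclideanSpace ℝ (Fin 3)) ρ')) :
    ContinuousOn (fun s => ∫ x in ball (0 : EuclideanSpace ℝ (Fin 3)) ρ, ‖w s x‖ ^ 2) (Icc a b) := by
  have hK : IsCompact (Icc a b ×ˢ closedBall (0 : EuclideanSpace ℝ (Fin 3)) ρ') := isCompact_Icc.prod (isCompact_closedBall _ _)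
  obtain ⟨C, hC⟩ := hK.exists_bound_of_continuousOn hw
  have hsub : ball (0 : EuclideanSpace ℝ (Fin 3)) ρ ⊆ closedBall (0 : EuclideanSpace ℝ (Fin 3)) ρ' :=
    ball_subset_closedBall.trans (closedBall_subset_closedBall hρ)
  have hslice : ∀ s ∈ Icc a b, ContinuousOn (fun x => ‖w s x‖ ^ 2) (closedBall (0 : EuclideanSpace ℝ (Fin 3)) ρ') := by
    intro s hs
    have hι : Continuous fun x : EuclideanSpace ℝ (Fin 3) => (s, x) := by fun_prop
    exact ((hw.comp hι.continuousOn fun x hx => ⟨hs, hx⟩).norm).pow 2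
  refine continuousOn_of_dominated (μ := volume.restrict (ball (0 : EuclideanSpace ℝ (Fin 3)) ρ))
    (bound := fun _ => C ^ 2) ?_ ?_ ?_ ?_
  · intro s hs
    exact ((hslice s hs).mono hsub).aestronglyMeasurable measurableSet_ball
  · intro s hs
    refine (ae_restrict_iff' measurableSet_ball).2 (Eventually.of_forall fun x hx => ?_)
    have h1 : ‖w s x‖ ≤ C := hC (s, x) ⟨hs, hsub hx⟩
    rw [Real.norm_of_nonneg (by positivity)]
    exact pow_le_pow_left₀ (norm_nonneg _) h1 2
  · exact integrableOn_const measure_ball_lt_top.ne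
  · refine (ae_restrict_iff' measurableSet_ball).2 (Eventually.of_forall fun x hx => ?_)
    have hι : Continuous fun s : ℝ => (s, x) := by fun_prop
    exact ((hw.comp hι.continuousOn fun s hs => ⟨hs, hsub hx⟩).norm).pow 2

/-- **Chebyshev + pull-back**, generic form. -/
theorem chebyshev_pullback_generic (w : ℝ → EuclideanSpace ℝ (Fin 3) → EuclideanSpace ℝ (Fin 3)) {tb τ θ R : ℝ}
    (htb : tb < 0) (hτ : 0 < τ) (hτ1 : τ ≤ 1 / 8000) (hθ : 0 < θ) (hR : 0 < R)
    (hw : ContinuousOn (uncurry w)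
      (Icc (τ * (-tb)) (2 * (τ * (-tb))) ×ˢ closedBall (0 : EuclideanSpace ℝ (Fin 3)) (4 * R * Real.sqrt (-tb))))
    (hJ : Jcore w (3 * R * Real.sqrt (-tb)) (τ * (-tb)) ≤ (τ * (-tb)) * (θ ^ 2 / (5 * Real.sqrt (-tb)))) :
    ∃ s ∈ Icc (τ * (-tb)) (2 * (τ * (-tb))),
      ∫⁻ x in ball (0 : EuclideanSpace ℝ (Fin 3)) (2 * R * Real.sqrt (-(tb - s))), ENNReal.ofReal (‖w s x‖ ^ 2) ≤
        ENNReal.ofReal (θ ^ 2 / (4 * Real.sqrt (-(tb - s)))) := by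
  have hn : 0 < -tb := by linarith
  set ℓ := Real.sqrt (-tb) with hℓdef
  have hℓ : 0 < ℓ := Real.sqrt_pos.2 hn
  have hℓ2 : ℓ ^ 2 = -tb := Real.sq_sqrt hn.le
  set t₀ := τ * (-tb) with ht₀def
  have ht₀ : 0 < t₀ := mul_pos hτ hn
  have hle : t₀ ≤ 2 * t₀ := by linarith
  -- the slice function and its integrability on `[t₀, 2t₀]`
  have hF : ContinuousOn (fun s => ∫ x in ball (0 : EuclideanSpace ℝ (Fin 3)) (3 * R * ℓ), ‖w s x‖ ^ 2) (Icc t₀ (2 * t₀)) :=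
    continuousOn_sqNormIntegral (by nlinarith) hw
  have hFint : IntegrableOn (fun s => ∫ x in ball (0 : EuclideanSpace ℝ (Fin 3)) (3 * R * ℓ), ‖w s x‖ ^ 2) (Icc t₀ (2 * t₀)) :=
    hF.integrableOn_compact isCompact_Icc
  -- Chebyshev: a point below the average
  have hμ0 : volume (Icc t₀ (2 * t₀)) ≠ 0 := by
    rw [Real.volume_Icc]; exact (ENNReal.ofReal_pos.2 (by linarith)).ne'
  have hμ1 : volume (Icc t₀ (2 * t₀)) ≠ ∞ := by rw [Real.volume_Icc]; exact ENNReal.ofReal_ne_top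
  obtain ⟨s, hs, hsavg⟩ := exists_le_setAverage hμ0 hμ1 hFint
  have havg : ⨍ a in Icc t₀ (2 * t₀), (∫ x in ball (0 : EuclideanSpace ℝ (Fin 3)) (3 * R * ℓ), ‖w a x‖ ^ 2) ≤
      θ ^ 2 / (5 * ℓ) := by
    rw [setAverage_eq, Real.volume_real_Icc_of_le hle, integral_Icc_eq_integral_Ioc, ← intervalIntegral.integral_of_le hle,
      smul_eq_mul]
    have hJ' : ∫ a in t₀..2 * t₀, ∫ x in ball (0 : EuclideanSpace ℝ (Fin 3)) (3 * R * ℓ), ‖w a x‖ ^ 2 ≤ t₀ * (θ ^ 2 / (5 * ℓ)) := hJ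
    have h2 : (2 * t₀ - t₀)⁻¹ = t₀⁻¹ := by ring_nf
    rw [h2]
    calc t₀⁻¹ * ∫ a in t₀..2 * t₀, ∫ x in ball (0 : EuclideanSpace ℝ (Fin 3)) (3 * R * ℓ), ‖w a x‖ ^ 2
        ≤ t₀⁻¹ * (t₀ * (θ ^ 2 / (5 * ℓ))) := mul_le_mul_of_nonneg_left hJ' (inv_nonneg.2 ht₀.le)
      _ = θ ^ 2 / (5 * ℓ) := by field_simp
  have hFs : ∫ x in ball (0 : EuclideanSpace ℝ (Fin 3)) (3 * R * ℓ), ‖w s x‖ ^ 2 ≤ θ ^ 2 / (5 * ℓ) := hsavg.trans havg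
  refine ⟨s, hs, ?_⟩
  -- geometry of the pull-back
  have hs1 : t₀ ≤ s := hs.1
  have hs2 : s ≤ 2 * t₀ := hs.2
  have hnt : 0 < -(tb - s) := by linarith
  have hup : -(tb - s) ≤ (5 * ℓ / 4) ^ 2 := by
    have : -(tb - s) ≤ (1 + 2 * τ) * ℓ ^ 2 := by rw [hℓ2]; nlinarith
    nlinarith
  have hsq : Real.sqrt (-(tb - s)) ≤ 5 * ℓ / 4 := by
    calc Real.sqrt (-(tb - s)) ≤ Real.sqrt ((5 * ℓ / 4) ^ 2) := Real.sqrt_le_sqrt hup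
      _ = 5 * ℓ / 4 := Real.sqrt_sq (by positivity)
  have hsqpos : 0 < Real.sqrt (-(tb - s)) := Real.sqrt_pos.2 hnt
  have hballsub : ball (0 : EuclideanSpace ℝ (Fin 3)) (2 * R * Real.sqrt (-(tb - s))) ⊆
      ball (0 : EuclideanSpace ℝ (Fin 3)) (3 * R * ℓ) :=
    ball_subset_ball (by nlinarith)
  -- integrability of the slice on the big ball
  have hslice : ContinuousOn (fun x => ‖w s x‖ ^ 2) (closedBall (0 : EuclideanSpace ℝ (Fin 3)) (4 * R * ℓ)) := by
    have hι : Continuous fun x : EuclideanSpace ℝ (Fin 3) => (s, x) := by fun_prop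
    exact ((hw.comp hι.continuousOn fun x hx => ⟨hs, hx⟩).norm).pow 2
  have hint : IntegrableOn (fun x => ‖w s x‖ ^ 2) (ball (0 : EuclideanSpace ℝ (Fin 3)) (3 * R * ℓ)) :=
    (hslice.integrableOn_compact (isCompact_closedBall _ _)).mono_set
      (ball_subset_closedBall.trans (closedBall_subset_closedBall (by nlinarith)))
  calc ∫⁻ x in ball (0 : EuclideanSpace ℝ (Fin 3)) (2 * R * Real.sqrt (-(tb - s))), ENNReal.ofReal (‖w s x‖ ^ 2)
      ≤ ∫⁻ x in ball (0 : EuclideanSpace ℝ (Fin 3)) (3 * R * ℓ), ENNReal.ofReal (‖w s x‖ ^ 2) := lintegral_mono_set hballsub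
    _ = ENNReal.ofReal (∫ x in ball (0 : EuclideanSpace ℝ (Fin 3)) (3 * R * ℓ), ‖w s x‖ ^ 2) :=
        (ofReal_integral_eq_lintegral_ofReal hint (Eventually.of_forall fun x => by positivity)).symm
    _ ≤ ENNReal.ofReal (θ ^ 2 / (5 * ℓ)) := ENNReal.ofReal_le_ofReal hFs
    _ ≤ ENNReal.ofReal (θ ^ 2 / (4 * Real.sqrt (-(tb - s)))) := by
        apply ENNReal.ofReal_le_ofReal
        apply div_le_div_of_nonneg_left (by positivity) (by positivity)
        linarith

/-! ## Stub B4 -/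

/-- **Stub B4** `ChebyshevPullbackS29` holds (instance `w s = curl (u (t̄ − s))` of `chebyshev_pullback_generic`, `t' = t̄ − s`). -/
theorem chebyshevPullbackS29_holds : ChebyshevPullbackS29 := by
  intro u tb τ θ R htb hτ hτ1 hθ hR hcont hJ
  obtain ⟨s, hs, hmain⟩ := chebyshev_pullback_generic (fun s x => curl (u (tb - s)) x) htb hτ hτ1 hθ hR hcont hJ
  refine ⟨tb - s, ⟨?_, ?_⟩, hmain⟩
  · have := hs.2; nlinarith
  · have := hs.1; nlinarith

end Summit.NavierStokesRegularity.NavierStokesRegularity.Theorems.PeepholeVorticityDoor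

end
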